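import Mathlib.RingTheory.Henselian
import Mathlib.RingTheory.Valuation.Integral
import Mathlib.RingTheory.Valuation.ValuationSubring
import Mathlib.FieldTheory.IsAlgClosed.Basic
import HarnessLib

/-!
# The valuation ring of an algebraically closed valued field is henselian (Stacks 0ASP with 04GG)

Topic `Literature/RingTheory/Valuation`; namespace `Literature.RingTheory.Valuation`.  PROOF FILE (theorems only; no definition, no named
fact, no instance, no `sorry`).  Cell `hodgecm-mathlib` (D-0151), FLOOR-0 P5a (D9op road 2′, ED4 cut of `Cruxes/HLiu418/Lines/F0_D9opRoad2.lean`):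
letter **Hb** `ValuationSubringHenselianOfIsAlgClosed` of the H desk (`F0/P5a/H-desk-signatures.rf.v1.F0P5a-plan-g0.lean`): the instance
`[HenselianLocalRing R]` for `R = ℤ̄_{𝔓₀}` (★ `absIntegersValuationSubring (adicCompletionPrime F w)`) and for `R =` ★ `closureValuationSubring (K̄_w)`
that the Hensel-lifting letter H consumes.

**The statement.** [StacksProject, Tag 0ASP] (with Tag 04GG (1)⇔(5)): for an algebraically closed field `Ω` and any valuation subring
`A ⊆ Ω`, the local ring `A` is henselian — in Mathlib's form (`HenselianLocalRing`): a monic `f ∈ A[X]` with `f(a₀) ∈ 𝔪_A` (and `f'(a₀)` a unit,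
NOT used) has a root `a ∈ A` with `a ≡ a₀ (mod 𝔪_A)`.  PROOF: `f` splits over `Ω` (algebraically closed), its roots are integral over `A`, hence lie
in `A` (a valuation ring is integrally closed in its fraction field `Ω`; Mathlib `Valuation.Integers.mem_of_integral`); then
`f(a₀) = ∏_α (a₀ − α)` is a product of elements of `A` of valuation `< 1`, so some factor has valuation `< 1`, i.e. some root `α ≡ a₀ (mod 𝔪_A)`.

* `ValuationSubring.integers_self` — `A` is a ring of integers of its own valuation (bookkeeping for Mathlib's `Valuation.Integers` API);
* `ValuationSubring.mem_of_isRoot_map_of_monic` — roots in `Ω` of a monic polynomial over `A` lie in `A`;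
* **`ValuationSubring.henselianLocalRing_of_isAlgClosed`** — the theorem (a `theorem`, not an instance; bind with `haveI`).

HC_CM is proved only modulo the 7 printed citations until rung 0 closes; this file is generic valuation theory.

## References
* [StacksProject] The Stacks project, Tag 0ASP (henselian valuation rings; the valuation ring of an algebraically closed field) and
  Tag 04GG (characterisations of henselian local rings).
* [BoschLutkebohmertRaynaud1990] S. Bosch, W. Lütkebohmert, M. Raynaud, *Néron Models* (1990), §2.3 Prop. 5 (the consumer: lifting of points
  of smooth schemes over a henselian base).
-/

set_option autoImplicit false

noncomputable section

universe u

open Polynomial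

namespace Literature.RingTheory.Valuation

variable {Ω : Type u} [Field Ω] (A : ValuationSubring Ω)

/-- A valuation subring `A ⊆ Ω` is a ring of integers of its valuation `A.valuation` in Mathlib's sense (`Valuation.Integers`):
the inclusion is injective, lands in valuation `≤ 1`, and every element of valuation `≤ 1` lies in `A`. [cite: StacksProject, Tag 0ASP] -/
theorem _root_.ValuationSubring.integers_self : A.valuation.Integers A where
  hom_inj := Subtype.val_injective
  map_le_one := A.valuation_le_one
  exists_of_le_one r hr := ⟨⟨r, (A.valuation_le_one_iff r).1 hr⟩, rfl⟩

/-- **Roots in `Ω` of a monic polynomial over a valuation subring `A ⊆ Ω` lie in `A`** (they are integral over `A`, and a valuation ring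
is integrally closed in its fraction field; Mathlib `Valuation.Integers.mem_of_integral`). [cite: StacksProject, Tag 0ASP] -/
theorem _root_.ValuationSubring.mem_of_isRoot_map_of_monic {f : A[X]} (hf : f.Monic) {α : Ω}
    (hα : (f.map (algebraMap A Ω)).IsRoot α) : α ∈ A := by
  have hint : IsIntegral A α := ⟨f, hf, by rwa [IsRoot.def, eval_map] at hα⟩
  have hmem := Valuation.Integers.mem_of_integral A.integers_self hint
  rw [Valuation.mem_integer_iff] at hmem
  exact (A.valuation_le_one_iff α).1 hmem

/-- **[StacksProject, Tag 0ASP]: the valuation ring of an algebraically closed valued field is henselian.**  For `Ω` algebraically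
closed and `A ⊆ Ω` a valuation subring, `A` satisfies Hensel's lemma in Mathlib's form `HenselianLocalRing` (indeed without the
derivative hypothesis): a monic `f ∈ A[X]` with `f(a₀) ∈ 𝔪_A` has a root `a ∈ A` with `a − a₀ ∈ 𝔪_A`, because `f = ∏ (X − αᵢ)` with all
`αᵢ ∈ A` and `∏ (a₀ − αᵢ) = f(a₀)` has valuation `< 1`. [cite: StacksProject, Tag 0ASP and Tag 04GG] -/
theorem _root_.ValuationSubring.henselianLocalRing_of_isAlgClosed [IsAlgClosed Ω] : HenselianLocalRing A := by
  refine ⟨fun f hf a₀ h₀ _ => ?_⟩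
  -- `f` splits over `Ω`; evaluate at `a₀`: `f(a₀) = ∏_α (a₀ - α)` in `Ω`
  have hsplit : (f.map (algebraMap A Ω)).Splits := IsAlgClosed.splits _
  have hgm : (f.map (algebraMap A Ω)).Monic := hf.map _
  have h1 : ((f.eval a₀ : A) : Ω) = (f.map (algebraMap A Ω)).eval (a₀ : Ω) := by
    rw [eval_map]
    exact (eval₂_at_apply (algebraMap A Ω) a₀).symm
  have heval : ((f.eval a₀ : A) : Ω) = ((f.map (algebraMap A Ω)).roots.map (fun α => (a₀ : Ω) - α)).prod := by
    rw [h1, hsplit.eval_eq_prod_roots, hgm.leadingCoeff, one_mul]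
  -- `v(f(a₀)) < 1`
  have hlt : A.valuation ((f.eval a₀ : A) : Ω) < 1 := (A.valuation_lt_one_iff _).1 h₀
  rw [heval, map_multiset_prod, Multiset.map_map] at hlt
  -- all roots lie in `A`, so all factors `a₀ - α` have valuation `≤ 1`; if none were `< 1` the product would be `1`
  have hroots : ∀ α ∈ (f.map (algebraMap A Ω)).roots, α ∈ A := fun α hα =>
    A.mem_of_isRoot_map_of_monic hf ((mem_roots hgm.ne_zero).1 hα)
  by_contra hcon
  push Not at hcon
  have hall : ∀ α ∈ (f.map (algebraMap A Ω)).roots, A.valuation ((a₀ : Ω) - α) = 1 := by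
    intro α hα
    have hmemA : (a₀ : Ω) - α ∈ A := A.sub_mem a₀.2 (hroots α hα)
    rcases A.valuation_lt_one_or_eq_one ⟨_, hmemA⟩ with h | h
    · -- then `⟨α, _⟩ ∈ A` is a root of `f` congruent to `a₀`: contradiction with `hcon`
      exfalso
      refine hcon ⟨α, hroots α hα⟩ ?_ ?_
      · -- `f(α) = 0` in `A` since `(f.map _)(α) = 0` in `Ω` and `A → Ω` is injective
        have hr : (f.map (algebraMap A Ω)).eval α = 0 := (mem_roots hgm.ne_zero).1 hα
        have hval : algebraMap A Ω (f.eval ⟨α, hroots α hα⟩) = (f.map (algebraMap A Ω)).eval α := by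
          rw [eval_map]
          exact (eval₂_at_apply (algebraMap A Ω) (⟨α, hroots α hα⟩ : A)).symm
        rw [IsRoot.def]
        apply IsFractionRing.injective A Ω
        rw [map_zero, hval, hr]
      · -- `α - a₀ ∈ 𝔪_A`, i.e. `v(α - a₀) = v(a₀ - α) < 1`
        rw [A.valuation_lt_one_iff, ← Valuation.map_neg]
        convert h using 2
        push_cast
        ring
    · exact h
  have hprod : (Multiset.map (⇑A.valuation ∘ fun α => (a₀ : Ω) - α) (f.map (algebraMap A Ω)).roots).prod = 1 :=
    Multiset.prod_eq_one fun x hx => by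
      obtain ⟨α, hα, rfl⟩ := Multiset.mem_map.1 hx
      exact hall α hα
  rw [hprod] at hlt
  exact lt_irrefl _ hlt

end Literature.RingTheory.Valuation

end
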